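import Summits.HodgeConjecture.HodgeConjecture.Theorems.MarkmanPartnerTransportIsometrySpannedThirdTopDegree
import Summits.HodgeConjecture.HodgeConjecture.Theorems.MarkmanPartnerTransportPartnerTransportInverse
import Literature.AlgebraicGeometry.Hyperkaehler.K3HilbertSquareTypeCohomology
import Literature.AlgebraicGeometry.HodgeTheory.HodgeClassOfMorphismDuality
import Literature.AlgebraicGeometry.HodgeTheory.BettiUniverseAxioms
import Literature.AlgebraicGeometry.HodgeTheory.ComplexOrientationFamily

/-!
# Route MarkmanPartnerTransport · support #3 `IsometrySpannedThird` — the `q`-SELF-ADJOINT ENDOMORPHISM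
# `F_c` of `H²(X)` attached to a class `c ∈ H⁴(X)` of a marked `K3^{[2]}`-type fourfold

For a marked smooth projective fourfold `(X, φ, P, z)` ((m1)–(m6)) and `c ∈ H⁴(X(ℂ); ℂ)` there is a unique
`ℂ`-linear `F_c : H²(X) → H²(X)` with

  `(c ∪ y) ∪ w = q(φ F_c y, φ w) · P`  for all `y, w ∈ H²(X)`

(`H⁸ = ℂ·P`, `q` non-degenerate).  This file: existence (`exists_classEndomorphism`), and for any `F`
satisfying the displayed identity: `q`-self-adjointness, RATIONALITY (`c, y` rational ⇒ `F y` rational: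
`(c ∪ y) ∪ αₖ` is a rational multiple of the integral generator `P`), HODGE property (`c` of type `(2,2)`
⇒ `F` type-preserving: cup products respect types and `H⁸ = H^{4,4}`), and UNIQUENESS of `c` given
`F` (cup products span `H⁴`, `VerbitskyGuan_cohomology_K3HilbertSquareType`; Poincaré duality).  The
partner-free analysis of the `E = ℚ` third of `IsometrySpannedThird` runs through `F_c` (seat notes, gen 6).

No definition, no sorry; the only named fact is `VerbitskyGuan_cohomology_K3HilbertSquareType` (hypothesis of
the uniqueness lemma). Prover seat hodge-nonav-19652-p1 (gen 6), `--supports stmt-HodgeConjecture-19651`.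

References: K. O'Grady, *Mat. Contemp.* (2008) §2; S. Novario, Kyoto J. Math. 66 (2026) §4–6; C. Voisin,
*Hodge Theory I* §7.1, §11.
-/

noncomputable section

set_option linter.dupNamespace false

open scoped Matrix
open Module CategoryTheory
open Literature.AlgebraicTopology.SingularHomology Literature.Geometry.Kaehler
open Literature.AlgebraicGeometry Literature.AlgebraicGeometry.Motives Literature.AlgebraicGeometry.HodgeTheory
open Literature.AlgebraicGeometry.Hyperkaehler Literature.AlgebraicGeometry.Surfaces
open Summit.HodgeConjecture.HodgeConjecture.Theorems.NikulinTwinTransport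
open Summit.HodgeConjecture.HodgeConjecture.Theorems.MarkmanPartnerTransport.BBFPositivity

namespace Summit.HodgeConjecture.HodgeConjecture.Theorems.MarkmanPartnerTransport.PartnerLattice

/-- `MarkedK3Sq[X, φ, P, z]`: VERBATIM the `let MarkedK3Sq := …` binder of the route declarations of
MarkmanPartnerTransport (clauses (m1)–(m6)). Local notation only. -/
local notation3 (prettyPrint := false) "MarkedK3Sq[" X ", " φ ", " P ", " z "]" =>
  (((IsIntegralClass P ∧ ∀ Q : complexBetti X (2 * 4), IsIntegralClass Q → ∃ n : ℤ, Q = n • P) ∧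
    (∀ c : complexBetti X 2, IsIntegralClass c ↔ ∃ v : K3HilbertIndex → ℤ, φ c = fun i => (v i : ℂ)) ∧
    (∀ a : complexBetti X 2, cupPowTwo a 4 = ((3 : ℂ) * (k3HilbertForm 2 (φ a) (φ a)) ^ 2) • P) ∧
    (IsOfHodgeType 4 X 2 2 0 (LinearEquiv.symm φ z) ∧
      ∀ τ : complexBetti X 2, IsOfHodgeType 4 X 2 2 0 τ → ∃ t : ℂ, τ = t • LinearEquiv.symm φ z) ∧
    (∀ c : complexBetti X 2, IsOfHodgeType 4 X 2 1 1 c ↔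
      (k3HilbertForm 2 (φ c) z = 0 ∧ k3HilbertForm 2 (φ c) (star z) = 0)) ∧
    (k3HilbertForm 2 z z = 0 ∧ 0 < (k3HilbertForm 2 (star z) z).re)))

/-- `qC` = the complex Beauville–Bogomolov form on `ℂ²³` as a Mathlib bilinear form. Local notation only. -/
local notation3 (prettyPrint := false) "qC" => Matrix.toBilin' (Matrix.map (k3HilbertGram 2) (Int.cast : ℤ → ℂ))

/-- `Cup3[c, y, w] = (c ∪ y) ∪ w ∈ H⁸` for `c ∈ H⁴`, `y, w ∈ H²`. Local notation only. -/
local notation3 (prettyPrint := false) "Cup3[" c ", " y ", " w "]" =>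
  cupProduct (rfl : 2 * 3 + 2 = 2 * 4) (cupProduct (rfl : 2 * 2 + 2 = 2 * 3) c y) w

variable {X : SchemeOver ℂ} {φ : complexBetti X 2 ≃ₗ[ℂ] (K3HilbertIndex → ℂ)} {P : complexBetti X (2 * 4)}
  {z : K3HilbertIndex → ℂ}

/-! ### Existence -/

/-- **The endomorphism `F_c` of a degree-`4` class**: for `c ∈ H⁴(X)` there is a `ℂ`-linear `F` with
`(c ∪ y) ∪ w = q(φ F y, φ w) · P` (coefficient along `P` of the top class, dualised by the non-degenerate
form `q`). [cite: OGrady2008NumericalK3Square, §2.1–2.2] [cite: VoisinHodgeI2002, §7.1.2] -/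
theorem exists_classEndomorphism (hX : IsSmoothProjective 4 X) (hM : MarkedK3Sq[X, φ, P, z])
    (c : complexBetti X (2 * 2)) :
    ∃ F : complexBetti X 2 →ₗ[ℂ] complexBetti X 2,
      ∀ y w : complexBetti X 2, Cup3[c, y, w] = (k3HilbertForm 2 (φ (F y)) (φ w)) • P := by
  classical
  have hP := generator_ne_zero_of_markedSq hX hM
  have h1 : Module.finrank ℂ (complexBetti X (2 * 4)) = 1 := finrank_complexBetti_top hX
  haveI : FiniteDimensional ℂ (complexBetti X (2 * 4)) := Module.finite_of_finrank_eq_succ h1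
  -- the coordinate `λ` along `P`
  set bP := FiniteDimensional.basisSingleton Unit h1 P hP with hbP
  set lam : complexBetti X (2 * 4) →ₗ[ℂ] ℂ := bP.coord default with hlam
  have hlamx : ∀ x : complexBetti X (2 * 4), x = lam x • P := by
    intro x
    have h := bP.sum_repr x
    rw [Fintype.sum_unique] at h
    have hb : bP default = P := FiniteDimensional.basisSingleton_apply Unit h1 P hP default
    rw [hb] at h
    exact h.symm
  -- the bilinear coefficient form `(y, w) ↦ λ((c ∪ y) ∪ w)`
  set τ : complexBetti X 2 →ₗ[ℂ] complexBetti X 2 →ₗ[ℂ] ℂ :=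
    (LinearMap.llcomp ℂ (complexBetti X 2) (complexBetti X (2 * 4)) ℂ lam) ∘ₗ
      (cupProduct (rfl : 2 * 3 + 2 = 2 * 4)) ∘ₗ (cupProduct (rfl : 2 * 2 + 2 = 2 * 3) c) with hτ
  have hτapp : ∀ y w, τ y w = lam (Cup3[c, y, w]) := fun y w => rfl
  -- dualise in `ℂ²³`
  set F : complexBetti X 2 →ₗ[ℂ] complexBetti X 2 :=
    (φ.symm : (K3HilbertIndex → ℂ) →ₗ[ℂ] complexBetti X 2) ∘ₗ
      ((qC).toDual qC_nondegenerate).symm.toLinearMap ∘ₗ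
      (φ.symm : (K3HilbertIndex → ℂ) →ₗ[ℂ] complexBetti X 2).dualMap ∘ₗ τ with hF
  refine ⟨F, fun y w => ?_⟩
  have hq : k3HilbertForm 2 (φ (F y)) (φ w) = lam (Cup3[c, y, w]) := by
    rw [← qC_apply, hF]
    simp only [LinearMap.comp_apply, LinearEquiv.coe_coe, LinearEquiv.apply_symm_apply]
    rw [LinearMap.BilinForm.apply_toDual_symm_apply, LinearMap.dualMap_apply, LinearEquiv.coe_coe,
      LinearEquiv.symm_apply_apply, hτapp]
  rw [hq]
  exact hlamx _

/-! ### Properties of any `F` with `(c ∪ y) ∪ w = q(φ F y, φ w) · P` -/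

variable {c : complexBetti X (2 * 2)} {F : complexBetti X 2 →ₗ[ℂ] complexBetti X 2}

/-- Coefficients along `P` can be compared. [folklore] -/
theorem smul_generator_injective (hX : IsSmoothProjective 4 X) (hM : MarkedK3Sq[X, φ, P, z]) {s t : ℂ}
    (h : s • P = t • P) : s = t :=
  smul_left_injective ℂ (generator_ne_zero_of_markedSq hX hM) h

/-- **`F_c` is `q`-self-adjoint**: `(c ∪ y) ∪ w = (c ∪ w) ∪ y`. [cite: HatcherAT2002, §3.2 Thm. 3.11] -/
theorem classEndomorphism_selfAdjoint (hX : IsSmoothProjective 4 X) (hM : MarkedK3Sq[X, φ, P, z])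
    (hF : ∀ y w : complexBetti X 2, Cup3[c, y, w] = (k3HilbertForm 2 (φ (F y)) (φ w)) • P)
    (y w : complexBetti X 2) : k3HilbertForm 2 (φ (F y)) (φ w) = k3HilbertForm 2 (φ y) (φ (F w)) := by
  have hsymm : Cup3[c, y, w] = Cup3[c, w, y] := by
    rw [cupProduct_assoc (rfl : 2 * 2 + 2 = 2 * 3) (rfl : 2 + 2 = 2 * 2) (rfl : 2 * 3 + 2 = 2 * 4)
        (rfl : 2 * 2 + 2 * 2 = 2 * 4) c y w,
      cupProduct_assoc (rfl : 2 * 2 + 2 = 2 * 3) (rfl : 2 + 2 = 2 * 2) (rfl : 2 * 3 + 2 = 2 * 4)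
        (rfl : 2 * 2 + 2 * 2 = 2 * 4) c w y, cupProduct_two_two_comm y w]
  rw [hF, hF] at hsymm
  rw [smul_generator_injective hX hM hsymm, k3HilbertForm_comm]

/-- **`F_c` preserves rational classes when `c` is rational**: `(c ∪ y) ∪ αₖ` is rational, hence a
rational multiple of `P`, so `q(φ F y, eₖ) ∈ ℚ` for the rational basis `eₖ`, and `q` is non-degenerate over
`ℚ`. [cite: VoisinHodgeI2002, §7.1.1 and §7.1.2] -/
theorem isRationalClass_classEndomorphism (hX : IsSmoothProjective 4 X) (hM : MarkedK3Sq[X, φ, P, z])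
    (hF : ∀ y w : complexBetti X 2, Cup3[c, y, w] = (k3HilbertForm 2 (φ (F y)) (φ w)) • P)
    (hc : IsRationalClass c) {y : complexBetti X 2} (hy : IsRationalClass y) : IsRationalClass (F y) := by
  classical
  obtain ⟨-, hint, -⟩ := id hM
  -- the rational numbers `rₖ = q(φ F y, eₖ)`
  have hk : ∀ k : K3HilbertIndex, ∃ r : ℚ,
      k3HilbertForm 2 (φ (F y)) (fun i => ((Pi.single k (1 : ℚ) : K3HilbertIndex → ℚ) i : ℂ)) = (r : ℂ) := by
    intro k
    set α : complexBetti X 2 := φ.symm (fun i => ((Pi.single k (1 : ℚ) : K3HilbertIndex → ℚ) i : ℂ)) with hα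
    have hαrat : IsRationalClass α :=
      (isRationalClass_iff_of_markedSq hX hint α).2 ⟨Pi.single k 1, LinearEquiv.apply_symm_apply _ _⟩
    have hrat : IsRationalClass (Cup3[c, y, α]) := (hc.cup _ hy).cup _ hαrat
    obtain ⟨r, hr⟩ := exists_rat_smul_generator_of_isRationalClass hX hM hrat
    rw [hF, hα, LinearEquiv.apply_symm_apply] at hr
    exact ⟨r, smul_generator_injective hX hM hr⟩
  choose r hr using hk
  -- solve `qQ w eₖ = rₖ` over `ℚ`
  set L : (K3HilbertIndex → ℚ) →ₗ[ℚ] (K3HilbertIndex → ℚ) :=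
    { toFun := fun v k => Matrix.toBilin' (Matrix.map (k3HilbertGram 2) (Int.cast : ℤ → ℚ)) v (Pi.single k 1)
      map_add' := fun a b => by funext k; simp only [map_add, LinearMap.add_apply, Pi.add_apply]
      map_smul' := fun q a => by funext k; simp only [map_smul, LinearMap.smul_apply, Pi.smul_apply,
        RingHom.id_apply] } with hL
  have hLinj : Function.Injective L := by
    intro a b hab
    have h0 : ∀ k, Matrix.toBilin' (Matrix.map (k3HilbertGram 2) (Int.cast : ℤ → ℚ)) (a - b) (Pi.single k 1) = 0 := by
      intro k
      have := congrFun hab k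
      simp only [hL, LinearMap.coe_mk, AddHom.coe_mk] at this
      rw [map_sub, LinearMap.sub_apply, this, sub_self]
    have hab' : a - b = 0 := by
      refine qQ_nondegenerate.1 (a - b) fun w => ?_
      have hw : w = ∑ k, w k • (Pi.single k (1 : ℚ) : K3HilbertIndex → ℚ) := by
        conv_lhs => rw [← (Pi.basisFun ℚ K3HilbertIndex).sum_repr w]
        simp only [Pi.basisFun_repr, Pi.basisFun_apply]
      rw [hw, map_sum]
      exact Finset.sum_eq_zero fun k _ => by rw [map_smul, h0 k, smul_zero]
    exact sub_eq_zero.1 hab'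
  obtain ⟨w, hw⟩ := (LinearMap.surjective_of_injective hLinj) r
  refine (isRationalClass_iff_of_markedSq hX hint _).2 ⟨w, ?_⟩
  -- `φ (F y)` and `w` have the same `q`-pairings with the basis
  have hdiff : ∀ k : K3HilbertIndex, k3HilbertForm 2 (φ (F y) - fun i => (w i : ℂ))
      (fun i => ((Pi.single k (1 : ℚ) : K3HilbertIndex → ℚ) i : ℂ)) = 0 := by
    intro k
    rw [sub_eq_add_neg, k3HilbertForm_add_left, ← neg_one_smul ℂ, k3HilbertForm_smul_left, hr k,
      k3HilbertForm_ratCast]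
    have hwk : Matrix.toBilin' (Matrix.map (k3HilbertGram 2) (Int.cast : ℤ → ℚ)) w (Pi.single k 1) = r k := by
      have := congrFun hw k
      simpa [hL] using this
    rw [hwk]
    ring
  have h0 : φ (F y) - (fun i => (w i : ℂ)) = 0 := by
    refine qC_nondegenerate.1 _ fun v => ?_
    have hfun : qC (φ (F y) - fun i => (w i : ℂ)) = 0 := by
      refine (Pi.basisFun ℂ K3HilbertIndex).ext fun k => ?_
      have hk : (Pi.basisFun ℂ K3HilbertIndex) k =
          fun i => ((Pi.single k (1 : ℚ) : K3HilbertIndex → ℚ) i : ℂ) := by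
        funext i
        by_cases hi : i = k <;> simp [Pi.basisFun_apply, hi]
      rw [hk, qC_apply, hdiff k, LinearMap.zero_apply]
    rw [hfun, LinearMap.zero_apply]
  exact (sub_eq_zero.1 h0)

/-- **`F_c` is type-preserving when `c` is of type `(2,2)`**: `(c ∪ y) ∪ w` has type
`(2 + i + i', 2 + j + j')`, which is `(4,4)` only for complementary types, so `q(φ F y, φ w) = 0` otherwise;
the types of `H²` are then read off (m4)/(m5) and `exists_smul_period_of_orthogonal`.
[cite: VoisinHodgeI2002, §7.1.1 and §11.1] [cite: Beauville1983, §8–9] -/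
theorem isOfHodgeType_classEndomorphism (hX : IsSmoothProjective 4 X) (hM : MarkedK3Sq[X, φ, P, z])
    (hF : ∀ y w : complexBetti X 2, Cup3[c, y, w] = (k3HilbertForm 2 (φ (F y)) (φ w)) • P)
    (hc22 : IsOfHodgeType 4 X (2 * 2) 2 2 c) {i j : ℕ} {y : complexBetti X 2}
    (hy : IsOfHodgeType 4 X 2 i j y) : IsOfHodgeType 4 X 2 i j (F y) := by
  obtain ⟨-, hint, -, ⟨hz20, hz20span⟩, h11, -⟩ := id hM
  have hcup : CupPreservesHodgeType 4 X :=
    BettiUniverse.cupPreservesHodgeType exists_isReal_hodgeModel_holds hodgePQ_independent_of_hodgeModel_holds hX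
  -- vanishing of off-type pairings
  have hvan : ∀ {i' j' : ℕ} {w : complexBetti X 2}, IsOfHodgeType 4 X 2 i' j' w → i + j = 2 → i' + j' = 2 →
      i + i' ≠ 2 → k3HilbertForm 2 (φ (F y)) (φ w) = 0 := by
    intro i' j' w hw hij hij' hne
    have ht : IsOfHodgeType 4 X (2 * 4) (2 + i + i') (2 + j + j') (Cup3[c, y, w]) :=
      hcup (rfl : 2 * 3 + 2 = 2 * 4) (hcup (rfl : 2 * 2 + 2 = 2 * 3) hc22 hy) hw
    have h0 := eq_zero_of_isOfHodgeType_top_of_fst_ne_four hX (by omega) (by omega) ht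
    rw [hF] at h0
    have h0' : k3HilbertForm 2 (φ (F y)) (φ w) • P = (0 : ℂ) • P := by rw [h0, zero_smul]
    exact smul_generator_injective hX hM h0'
  have hσbar : IsOfHodgeType 4 X 2 0 2 (φ.symm (star z)) := by
    have e1 : conjClass (ComplexPoints X) 2 (φ.symm z) = φ.symm (star z) := by
      apply φ.injective
      rw [marking_conjClass hint, LinearEquiv.apply_symm_apply, LinearEquiv.apply_symm_apply]
    have h := hz20.conjClass hX
    rwa [e1] at h
  by_cases hij : i + j = 2
  · have hi2 : i ≤ 2 := by omega
    interval_cases i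
    · -- `(0,2)`: `F y ⟂ z̄`, `F y ⟂ H^{1,1}` ⇒ `conj (F y) ∈ ℂσ` ⇒ `F y ∈ ℂσ̄`
      have hj : j = 2 := by omega
      subst hj
      have h1 : k3HilbertForm 2 (φ (F y)) (star z) = 0 := by
        have := hvan hσbar rfl rfl (by norm_num)
        rwa [LinearEquiv.apply_symm_apply] at this
      have h2 : ∀ h : complexBetti X 2, IsOfHodgeType 4 X 2 1 1 h → k3HilbertForm 2 (φ (F y)) (φ h) = 0 :=
        fun h hh => hvan hh rfl rfl (by norm_num)
      -- conjugate
      set v := conjClass (ComplexPoints X) 2 (F y) with hv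
      have hvz : k3HilbertForm 2 (φ v) z = 0 := by
        rw [hv, marking_conjClass hint, ← star_star z, ← star_k3HilbertForm, h1, star_zero]
      have hv11 : ∀ h : complexBetti X 2, IsOfHodgeType 4 X 2 1 1 h → k3HilbertForm 2 (φ v) (φ h) = 0 := by
        intro h hh
        have := h2 _ (hh.conjClass hX)
        rw [marking_conjClass hint] at this
        rw [hv, marking_conjClass hint, ← star_star (φ h), ← star_k3HilbertForm, this, star_zero]
      obtain ⟨t, ht⟩ := exists_smul_period_of_orthogonal hM hvz hv11
      have hFy : F y = conjClass (ComplexPoints X) 2 (t • φ.symm z) := by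
        rw [← ht, hv, conjClass_conjClass]
      rw [hFy]
      exact (hz20.smul t).conjClass hX
    · -- `(1,1)`
      have hj : j = 1 := by omega
      subst hj
      refine (h11 _).2 ⟨?_, ?_⟩
      · have := hvan hz20 rfl rfl (by norm_num)
        rwa [LinearEquiv.apply_symm_apply] at this
      · have := hvan hσbar rfl rfl (by norm_num)
        rwa [LinearEquiv.apply_symm_apply] at this
    · -- `(2,0)`
      have hj : j = 0 := by omega
      subst hj
      have h1 : k3HilbertForm 2 (φ (F y)) z = 0 := by
        have := hvan hz20 rfl rfl (by norm_num)
        rwa [LinearEquiv.apply_symm_apply] at this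
      have h2 : ∀ h : complexBetti X 2, IsOfHodgeType 4 X 2 1 1 h → k3HilbertForm 2 (φ (F y)) (φ h) = 0 :=
        fun h hh => hvan hh rfl rfl (by norm_num)
      obtain ⟨t, ht⟩ := exists_smul_period_of_orthogonal hM h1 h2
      rw [ht]
      exact hz20.smul t
  · have hy0 : y = 0 := by
      obtain ⟨A, hA⟩ := hy
      rw [(A.hodgePQ_eq_bot_iff 2 i j).2
          (Literature.NumberTheory.Transcendental.hodgePQ_eq_bot_of_ne (M := A.carrier) hij),
        Submodule.mem_bot] at hA
      exact A.pullback_injective 2 (by rw [hA, map_zero])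
    rw [hy0, map_zero]
    exact isOfHodgeType_zero_of_isSmoothProjective nonempty_hodgeModel_holds hX 2 i j

/-! ### Uniqueness: `F_c = F_{c'} ⇒ c = c'` -/

/-- **A degree-`4` class is determined by its endomorphism**: if `(c ∪ y) ∪ w = (c' ∪ y) ∪ w` for all
`y, w ∈ H²`, then `c = c'` — cup products `y ∪ w` span `H⁴` (`VerbitskyGuan_cohomology_K3HilbertSquareType`)
and the cup pairing `H⁴ × H⁴ → H⁸` is perfect (Poincaré duality). [cite: Novario2026HodgeClassesHilbertSquares, Prop. 4.1]
[cite: HatcherAT2002, §3.3 Prop. 3.38] -/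
theorem eq_of_cup3_eq (hV : VerbitskyGuan_cohomology_K3HilbertSquareType) (hX : IsSmoothProjective 4 X)
    (hK : IsOfK3HilbertSquareType X) {c c' : complexBetti X (2 * 2)}
    (h : ∀ y w : complexBetti X 2, Cup3[c, y, w] = Cup3[c', y, w]) : c = c' := by
  obtain ⟨-, -, -, hspan⟩ := hV X hX hK
  -- `(c - c') ∪ x = 0` for every `x ∈ H⁴`
  have hzero : ∀ x : complexBetti X (2 * 2), cupProduct (rfl : 2 * 2 + 2 * 2 = 2 * 4) (c - c') x = 0 := by
    intro x
    have hx : x ∈ Submodule.span ℂ (Set.range fun ab : complexBetti X 2 × complexBetti X 2 ↦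
        cupProduct (rfl : 2 + 2 = 2 * 2) ab.1 ab.2) := by rw [hspan]; exact Submodule.mem_top
    induction hx using Submodule.span_induction with
    | mem x hx =>
      obtain ⟨⟨y, w⟩, rfl⟩ := hx
      simp only
      rw [← cupProduct_assoc (rfl : 2 * 2 + 2 = 2 * 3) (rfl : 2 + 2 = 2 * 2) (rfl : 2 * 3 + 2 = 2 * 4)
        (rfl : 2 * 2 + 2 * 2 = 2 * 4), map_sub, LinearMap.sub_apply, map_sub, LinearMap.sub_apply, h y w,
        sub_self]
    | zero => rw [map_zero]
    | add a b _ _ ha hb => rw [map_add, ha, hb, add_zero]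
    | smul t a _ ha => rw [map_smul, ha, smul_zero]
  -- Poincaré duality
  have hperf := isPerfPair_cupPairing_complexPoints complexOrientationFamily hX (rfl : 2 * 2 + 2 * 2 = 2 * 4)
  have hinj := hperf.bijective_left.1
  have h0 : cupPairing (complexOrientationFamily hX) (rfl : 2 * 2 + 2 * 2 = 2 * 4) (c - c') = 0 := by
    refine LinearMap.ext fun x => ?_
    rw [cupPairing_apply, hzero x, map_zero, LinearMap.zero_apply, LinearMap.zero_apply]
  have : c - c' = 0 := hinj (by rw [h0, map_zero])
  exact sub_eq_zero.1 this

end Summit.HodgeConjecture.HodgeConjecture.Theorems.MarkmanPartnerTransport.PartnerLattice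

end
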